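import Mathlib.Tactic.Ring
import Mathlib.Tactic.LinearCombination

/-!
# THE SUPERSINGULAR SHADOW: LEADER IDENTITIES (es §41.18) AND THE [j]- / [ι₄]-LEMMAS (es §41.15 (7), §41.16) AS RING IDENTITIES
# (cell `bsd-f2-manin`, planner `es` g27; T-es-43 + T-es-41 (i) + T-es-42 (ii, polynomial part); theorem-only, sorry-free, nothing conjectured)

TYPER NOTE (typer g18).  §1 = HOME/es/g27/ShadowLeader-es-g27.lean sha16 812b918ff2793824 VERBATIM (es: rc 0, 0 warnings; `import Mathlib` narrowed to
`Mathlib.Tactic.Ring` + `Mathlib.Tactic.LinearCombination`; namespace `EsG27.ShadowLeader` folded to `…ManinAdditive.KatoCurve.ShadowLeader`): the orbit power sums of a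
translation `X ↦ X + r` in characteristic `p ∈ {2, 3}` — constant for `k ≤ 2p − 2`, the Artin–Schreier norm form at `k = 2p − 1` (MEMO-es 41.18.2 (b)(c)).
§2 = T-es-41 (i), the **[j]-lemma** of MEMO-es 41.15.2 (7) / 41.15.5 (i), typed by the typer from es's checker HOME/es/g27/ss_jlemma.py f2685cfc4f80e4eb +
ss_shadow.py c82933d8497333a8 (SS-JLEMMA-v1.txt f2ab0f469df1cf64: 8/8 primes): on the supersingular curve `C₂ : Y² + Y = X³` in characteristic 2 with
`ω² + ω + 1 = 0`, the maps `ι(x, y) = (x + 1, y + x + ω)` (es's `iota`, the reduction of `[i]`) and `j(x, y) = (x + ω², y + ωx + ω)` (es's `jmap` with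
`t_j = ω`) preserve `C₂`, `ι² = j² = −1`, `j ι = ι⁻¹ j`, and the shadow weight `ν(x) = x(x + 1)` is `ι`-invariant with `ν ∘ j = ν + 1` — stated
coordinate-wise over ANY commutative ring with `2 = 0` and `ω² + ω + 1 = 0` (so in particular over every `𝔽_{2^{2f}}`), each proved by
`linear_combination` with explicit cofactors.  §3 = the polynomial part of T-es-42 (ii), the **[ι₄]-lemma** of MEMO-es 41.16 / E-es-128: on
`C₃ : Y² = X³ − X` the translation `τ(x, y) = (x + 1, y)` (reduction of `[ω̄]`, needs `3 = 0`) and `ι₄(x, y) = (−x, i·y)` (`i² = −1`) preserve `C₃`,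
`ι₄² = −1`, `ι₄ τ = τ⁻¹ ι₄`, and the shadow weight `ν₃ = y²` is `τ`-invariant and `ι₄`-ANTI-invariant (`ν₃ ∘ ι₄ = −ν₃`, the source of `S_{−t} = −S_t`).
NOT landed here (needs es binders / is not a polynomial identity): the module-theoretic step «`j(w̄) = δ·w̄` with `N(δ) ≡ −1 (mod ℓ)`» on `C[ℓ] ≅ ℤ[i]/ℓ`
and the shadow-VANISHING sum (T-es-41 (ii)), the shadow-moment `def` and the typed laws E-es-128/128′ (T-es-42 (i)), the leading-term Prop (T-es-41 (iii)) —
asked back to es as a Lean sketch with binders (STATUS line of this landing).  No `decide` instance over a concrete `𝔽_{2^6}` / `𝔽_{3^8}` is shipped: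
Mathlib's `GaloisField` does not reduce by `decide`, and `native_decide` is outside the gate's axiom whitelist.

HONEST FRAMING.  LENS: es (Euler systems / CM explicit reciprocity: the E₁-bit of the 32a ladder and its p = 3 twin on 27a, MEMO-es §41.15–41.18).
These are LEMMAS of es's paper proofs THEOREM 41.15 / 41.16 (the supersingular-shadow criterion for `v₂(A(χ))` / `v₃(A^±(χ))`), machine-checked here as
pure algebra; they assert nothing about L-values, `KatoFactTwoAt` / `KatoFactThreeAt`, Manin constants or BSD.  REFUTER VERDICTS: R-es-60 / R-es-61 (audit of
41.15 / 41.16, gaps G0–G7) PENDING at filing — these identities are gap G4/G5 material (orbit algebra, [j]/[ι₄] antisymmetry), not G0/G2.  PARTITION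
currency: 0; beyond-print theorem: NO (es: 41.18 is «pure algebra (Lucas + coset invariance); no literature claim»); bears_on: stmt-BirchSwinnertonDyer-22967
(C2, stub 6⁗ on 32a) and E-es-124/125/128.  BSD is not proved by this; Manin's conjecture is not proved; C2/C3 OPEN.
-/

namespace Summit.BirchSwinnertonDyer.Rank1Residual.ManinAdditive.KatoCurve.ShadowLeader

/-! ## §1 es §41.18 — the uniform LEADER LEMMA (HOME/es/g27/ShadowLeader-es-g27.lean 812b918ff2793824, verbatim)

# es g27 §41.18 — the uniform LEADER LEMMA behind THEOREMS 41.15 / 41.16 (sketch file, sorry-free)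

For an automorphism of order `p` of the minimal model reducing to the translation `X ↦ X + r̄`
on the supersingular fibre, the reduced orbit power sums are `Ō_k(X) = ∑_{c ∈ 𝔽_p} (X + c r̄)^k`.
They are CONSTANT for `k ≤ 2p − 2` and `Ō_{2p−1} = − r̄^{p−1} · (X^p − r̄^{p−1} X)` (+ `r̄³` if `p = 2`):
the Artin–Schreier norm form of the line `𝔽_p · r̄` — the «supersingular shadow» is the first
visible moment, at index `k = 2p − 1` (p = 2: X₃, 41.15/41.16.A; p = 3: X₅, 41.16).
Below: the identities for p = 2 (k = 2, 3) and p = 3 (k = 2, 3, 4, 5) in any commutative ring with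
`(p : R) = 0`, each as «closed form + p · (integer polynomial)» proved by `ring`.
-/

section CharTwo
variable {R : Type*} [CommRing R]

/-- p = 2, k = 2: `X² + (X + r)² = r²` (constant) when `2 = 0`. -/
theorem orbitSum_two_k2 (h2 : (2 : R) = 0) (X r : R) :
    X ^ 2 + (X + r) ^ 2 = r ^ 2 := by
  have : X ^ 2 + (X + r) ^ 2 = r ^ 2 + 2 * (X ^ 2 + X * r) := by ring
  rw [this, h2]; ring

/-- p = 2, k = 3 = 2p − 1: `X³ + (X + r)³ = r·(X² + r X) + r³` when `2 = 0` — the norm form `X(X + r)`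
of the line `{0, r}` appears first here (41.15 (5): X₃ = 6 r_i m₂). -/
theorem orbitSum_two_k3 (h2 : (2 : R) = 0) (X r : R) :
    X ^ 3 + (X + r) ^ 3 = r * (X ^ 2 + r * X) + r ^ 3 := by
  have : X ^ 3 + (X + r) ^ 3 = r * (X ^ 2 + r * X) + r ^ 3 + 2 * (X ^ 3 + X ^ 2 * r + X * r ^ 2) := by
    ring
  rw [this, h2]; ring

end CharTwo

section CharThree
variable {R : Type*} [CommRing R]

/-- p = 3, k = 2: constant `−r²`. -/
theorem orbitSum_three_k2 (h3 : (3 : R) = 0) (X r : R) :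
    X ^ 2 + (X + r) ^ 2 + (X + 2 * r) ^ 2 = -(r ^ 2) := by
  have : X ^ 2 + (X + r) ^ 2 + (X + 2 * r) ^ 2 = -(r ^ 2) + 3 * (X ^ 2 + 2 * X * r + 2 * r ^ 2) := by
    ring
  rw [this, h3]; ring

/-- p = 3, k = 3: `0`. -/
theorem orbitSum_three_k3 (h3 : (3 : R) = 0) (X r : R) :
    X ^ 3 + (X + r) ^ 3 + (X + 2 * r) ^ 3 = 0 := by
  have : X ^ 3 + (X + r) ^ 3 + (X + 2 * r) ^ 3 = 3 * (X ^ 3 + 3 * X ^ 2 * r + 5 * X * r ^ 2 + 3 * r ^ 3) := by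
    ring
  rw [this, h3]; ring

/-- p = 3, k = 4 = 2p − 2: constant `−r⁴`. -/
theorem orbitSum_three_k4 (h3 : (3 : R) = 0) (X r : R) :
    X ^ 4 + (X + r) ^ 4 + (X + 2 * r) ^ 4 = -(r ^ 4) := by
  have : X ^ 4 + (X + r) ^ 4 + (X + 2 * r) ^ 4
      = -(r ^ 4) + 3 * (X ^ 4 + 4 * X ^ 3 * r + 10 * X ^ 2 * r ^ 2 + 12 * X * r ^ 3 + 6 * r ^ 4) := by
    ring
  rw [this, h3]; ring

/-- p = 3, k = 5 = 2p − 1: `−r²·(X³ − r² X)` — the norm form `X³ − r²X = ∏_{c ∈ 𝔽₃}(X + c r)`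
(= `Y²` on the normal form `Y² = X³ − X`) appears first here (41.16 (3): Ō₅ = −r̄²(x̄³ − r̄²x̄)). -/
theorem orbitSum_three_k5 (h3 : (3 : R) = 0) (X r : R) :
    X ^ 5 + (X + r) ^ 5 + (X + 2 * r) ^ 5 = -(r ^ 2 * (X ^ 3 - r ^ 2 * X)) := by
  have : X ^ 5 + (X + r) ^ 5 + (X + 2 * r) ^ 5 = -(r ^ 2 * (X ^ 3 - r ^ 2 * X))
      + 3 * (X ^ 5 + 5 * X ^ 4 * r + 17 * X ^ 3 * r ^ 2 + 30 * X ^ 2 * r ^ 3 + 28 * X * r ^ 4 + 11 * r ^ 5) := by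
    ring
  rw [this, h3]; ring

/-- The norm form is translation invariant by the line: `ν(X + r) = ν(X)` for `ν(X) = X³ − r²X` when `3 = 0`. -/
theorem normForm_three_shift (h3 : (3 : R) = 0) (X r : R) :
    (X + r) ^ 3 - r ^ 2 * (X + r) = X ^ 3 - r ^ 2 * X := by
  have : (X + r) ^ 3 - r ^ 2 * (X + r) = X ^ 3 - r ^ 2 * X + 3 * (X ^ 2 * r + X * r ^ 2) := by ring
  rw [this, h3]; ring

end CharThree

/-! ## §2 The [j]-lemma on `C₂ : Y² + Y = X³` in characteristic 2 (T-es-41 (i); MEMO-es 41.15.2 (7), SS-JLEMMA-v1 8/8)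

Coordinates: a point is `(x, y)`; negation is `(x, y) ↦ (x, y + 1)`; `ι(x, y) = (x + 1, y + x + ω)`; `j(x, y) = (x + ω², y + ω·x + ω)`;
`ι⁻¹ = ι³ = −ι` is `(x, y) ↦ (x + 1, y + x + ω + 1)`; shadow weight `ν(x) = x·(x + 1)`.  Hypotheses throughout: `(2 : R) = 0`, `ω² + ω + 1 = 0`. -/

section CharTwoAutomorphisms
variable {R : Type*} [CommRing R]

/-- Negation preserves `C₂`: `(y + 1)² + (y + 1) = x³` when `2 = 0`. -/
theorem ssTwo_neg_onCurve (h2 : (2 : R) = 0) {x y : R} (h : y ^ 2 + y = x ^ 3) :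
    (y + 1) ^ 2 + (y + 1) = x ^ 3 := by
  linear_combination h + (y + 1) * h2

/-- Negation is an involution: `(y + 1) + 1 = y` when `2 = 0`. -/
theorem ssTwo_neg_neg (h2 : (2 : R) = 0) (y : R) : y + 1 + 1 = y := by
  linear_combination h2

/-- `ι` preserves `C₂`. -/
theorem ssTwo_iota_onCurve (h2 : (2 : R) = 0) {ω : R} (hω : ω ^ 2 + ω + 1 = 0) {x y : R} (h : y ^ 2 + y = x ^ 3) :
    (y + x + ω) ^ 2 + (y + x + ω) = (x + 1) ^ 3 := by
  linear_combination h + hω + (x * y + y * ω + x * ω - x ^ 2 - x - 1) * h2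

/-- `j` preserves `C₂`. -/
theorem ssTwo_jay_onCurve (h2 : (2 : R) = 0) {ω : R} (hω : ω ^ 2 + ω + 1 = 0) {x y : R} (h : y ^ 2 + y = x ^ 3) :
    (y + ω * x + ω) ^ 2 + (y + ω * x + ω) = (x + ω ^ 2) ^ 3 := by
  linear_combination h + (1 + (1 - ω) * (1 + ω ^ 3) + 3 * ω * x * (1 - ω)) * hω
    + (-ω ^ 2 * x ^ 2 + ω * x * y + ω * y + ω ^ 2 * x - ω * x - 1) * h2

/-- `ι² = −1`, first coordinate: `(x + 1) + 1 = x`. -/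
theorem ssTwo_iota_iota_fst (h2 : (2 : R) = 0) (x : R) : x + 1 + 1 = x := by
  linear_combination h2

/-- `ι² = −1`, second coordinate: `(y + x + ω) + (x + 1) + ω = y + 1`. -/
theorem ssTwo_iota_iota_snd (h2 : (2 : R) = 0) (ω x y : R) : y + x + ω + (x + 1) + ω = y + 1 := by
  linear_combination (x + ω) * h2

/-- `j² = −1`, first coordinate: `(x + ω²) + ω² = x`. -/
theorem ssTwo_jay_jay_fst (h2 : (2 : R) = 0) (ω x : R) : x + ω ^ 2 + ω ^ 2 = x := by
  linear_combination ω ^ 2 * h2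

/-- `j² = −1`, second coordinate: `(y + ωx + ω) + ω(x + ω²) + ω = y + 1`. -/
theorem ssTwo_jay_jay_snd (h2 : (2 : R) = 0) {ω : R} (hω : ω ^ 2 + ω + 1 = 0) (x y : R) :
    y + ω * x + ω + ω * (x + ω ^ 2) + ω = y + 1 := by
  linear_combination (ω * (x + 1)) * h2 + (ω - 1) * hω

/-- `j ι = ι⁻¹ j` (anticommutation in `Q₈`), first coordinate: `j(ι P)` and `ι⁻¹(j P)` both have abscissa `x + 1 + ω²`. -/
theorem ssTwo_jay_iota_fst (ω x : R) : x + 1 + ω ^ 2 = x + ω ^ 2 + 1 := by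
  ring

/-- `j ι = ι⁻¹ j`, second coordinate: `(y + x + ω) + ω(x + 1) + ω = ((y + ωx + ω) + (x + ω²) + ω) + 1`. -/
theorem ssTwo_jay_iota_snd (h2 : (2 : R) = 0) {ω : R} (hω : ω ^ 2 + ω + 1 = 0) (x y : R) :
    y + x + ω + ω * (x + 1) + ω = y + ω * x + ω + (x + ω ^ 2) + ω + 1 := by
  linear_combination (-1 : R) * hω + ω * h2

/-- The shadow weight `ν(x) = x(x + 1)` is `ι`-invariant (`μ₄`-invariance): `(x + 1)(x + 1 + 1) = x(x + 1)`. -/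
theorem ssTwo_nu_iota (h2 : (2 : R) = 0) (x : R) : (x + 1) * (x + 1 + 1) = x * (x + 1) := by
  linear_combination (x + 1) * h2

/-- **The [j]-lemma:** `ν(j P) = ν(P) + 1`, i.e. `(x + ω²)(x + ω² + 1) = x(x + 1) + 1`. -/
theorem ssTwo_nu_jay (h2 : (2 : R) = 0) {ω : R} (hω : ω ^ 2 + ω + 1 = 0) (x : R) :
    (x + ω ^ 2) * (x + ω ^ 2 + 1) = x * (x + 1) + 1 := by
  linear_combination (ω ^ 2 - ω + 1) * hω + (ω ^ 2 * x - 1) * h2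

end CharTwoAutomorphisms

/-! ## §3 The [ι₄]-lemma on `C₃ : Y² = X³ − X` (T-es-42 (ii), polynomial part; MEMO-es 41.16, E-es-128)

Coordinates: negation `(x, y) ↦ (x, −y)`; translation `τ(x, y) = (x + 1, y)` (the reduction of `[ω̄]`; needs `3 = 0`); `ι₄(x, y) = (−x, i·y)` with
`i² = −1`; `τ⁻¹(x, y) = (x − 1, y)`; shadow weight `ν₃(x, y) = y²`. -/

section CharThreeAutomorphisms
variable {R : Type*} [CommRing R]

/-- `τ` preserves `C₃` when `3 = 0`: `y² = (x + 1)³ − (x + 1)`. -/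
theorem ssThree_tau_onCurve (h3 : (3 : R) = 0) {x y : R} (h : y ^ 2 = x ^ 3 - x) :
    y ^ 2 = (x + 1) ^ 3 - (x + 1) := by
  linear_combination h - (x ^ 2 + x) * h3

/-- `ι₄` preserves `C₃` (any ring, `i² = −1`): `(i y)² = (−x)³ − (−x)`. -/
theorem ssThree_iotaFour_onCurve {i : R} (hi : i ^ 2 = -1) {x y : R} (h : y ^ 2 = x ^ 3 - x) :
    (i * y) ^ 2 = (-x) ^ 3 - (-x) := by
  linear_combination y ^ 2 * hi - h

/-- `ι₄² = −1`: `(−(−x), i(i y)) = (x, −y)`. -/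
theorem ssThree_iotaFour_iotaFour {i : R} (hi : i ^ 2 = -1) (x y : R) : (-(-x), i * (i * y)) = (x, -y) := by
  refine Prod.ext (by ring) ?_
  show i * (i * y) = -y
  linear_combination y * hi

/-- `ι₄ τ = τ⁻¹ ι₄` (anticommutation in the dicyclic group): `ι₄(x + 1, y) = (−x − 1, i y) = τ⁻¹(−x, i y)`. -/
theorem ssThree_iotaFour_tau (i x y : R) : (-(x + 1), i * y) = (-x - 1, i * y) :=
  Prod.ext (by ring) rfl

/-- The shadow weight `ν₃ = y²` is `τ`-invariant (trivially: `τ` fixes `y`) and, on the curve, equals the norm form `x³ − x = ∏_{c ∈ 𝔽₃} (x + c)`,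
which is translation invariant when `3 = 0`. -/
theorem ssThree_normForm_tau (h3 : (3 : R) = 0) (x : R) : (x + 1) ^ 3 - (x + 1) = x ^ 3 - x := by
  linear_combination (x ^ 2 + x) * h3

/-- **The [ι₄]-lemma:** `ν₃(ι₄ P) = −ν₃(P)`, i.e. `(i y)² = −y²` — the source of the antisymmetry `S_{−t} = −S_t` of E-es-128. -/
theorem ssThree_nu_iotaFour {i : R} (hi : i ^ 2 = -1) (y : R) : (i * y) ^ 2 = -(y ^ 2) := by
  linear_combination y ^ 2 * hi

end CharThreeAutomorphisms

end Summit.BirchSwinnertonDyer.Rank1Residual.ManinAdditive.KatoCurve.ShadowLeader
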